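import Summits.HubbardSuperconductivity.HubbardSuperconductivity.Theorems.WidthHaldaneTubeLandauWindow

/-!
# Stiffness from a Landau criterion on the Hubbard tube

Support file for crux `WidthUniformThermodynamics` (stmt-HubbardSuperconductivity-16312; routes
`WidthHaldane`, `SeamInduction`), continuing `WidthHaldaneTubeLandauForm.lean` /
`WidthHaldaneTubeLandauWindow.lean` (the Landau form `E(θ, N) = inf_ψ [Re⟨ψ,H₀ψ⟩ + (1 - cos(θ/L))K(ψ)
+ sin(θ/L)J(ψ)]` of the flux envelope, with the longitudinal kinetic form
`K(ψ) = Σ_{a,b,σ} Re⟨ψ,(c†_{(a,b)σ}c_{(a-1,b)σ} + h.c.)ψ⟩` and the total longitudinal current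
`J(ψ) = Σ_{a,b,σ} Im⟨ψ,(c†_{(a,b)σ}c_{(a-1,b)σ} - h.c.)ψ⟩` of the untwisted tube written out). The
reduction of the crux idea `Cruxes/WidthUniformThermodynamics/Ideas/landau-window-yrast.md` (its
`StiffnessOfLandauCriterion`), PROVED without definitions and without named facts:

* **`tubeStiffness_ge_of_landauCriterion`** / `stiffnessOfLandauCriterion` (closed form, the
  registered sub-goal) — at the cruxes' filling `N = N_{L,M}(δ)` (`δ ≥ -1`, `L ≥ 3`), a KINETIC
  FLOOR `K(ψ) ≥ k'·LM` on the window `Re⟨ψ,H₀ψ⟩ - E(0,N) ≤ wM/L` and the LANDAU CRITERION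
  `Re⟨ψ,H₀ψ⟩ - E(0,N) ≥ min(J(ψ)²/(2κLM), s|J(ψ)|/L)` for every unit vector of the sector
  `(N, S^z = 0)` (`0 < κ`, `π/3 < s`, `0 ≤ k' ≤ 2`, `2(π/3)² ≤ w(1 - (π/3)/s)`, `2(π/3)²(κ+2) ≤ w`)
  give `k'(1 - 1/L²) - κ ≤ ρ̃_{L,M}(U, δ)` (the card's constant `1 - (π/3)²/(12L²)` relaxed to
  `1 - 1/L²`). Conjunct (i) of the crux at one `(U, δ)` thus follows from two FLUX-FREE statements
  about `tubeH0` holding uniformly over the family: every state of the untwisted tube pays for the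
  current it carries (Landau), and low states keep their longitudinal kinetic energy.

A handle for a line of the crux typed in Landau form, not progress on its open core (the Landau
criterion uniformly in the width IS superconducting rigidity; `FLOOR-INVENTORY-k2r1.md` §0).
Calibration: at `U = 0` the criterion fails exactly on the open shells of
`Negative/WidthUniformThermodynamicsFreeOpenShell` (a degenerate shell partner carries current at no
cost), consistent with `widthUniformThermodynamics_false_at_zero_coupling`; by the reverse Bloch
bound `currentEnergyBound` the criterion is automatic outside the window `{ε ≲ M/L, |J| ≲ M}`.

References: F. Bloch, Phys. Rev. A 7 (1973) 2187 (flux ↔ current-carrying states); D. J. Scalapino,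
S. R. White, S. C. Zhang, PRB 47 (1993) 7995 §II (the stiffness criterion); H. Watanabe, J. Stat.
Phys. 177 (2019) 717, §2.2–§4.1.
-/

noncomputable section

namespace Summit.HubbardSuperconductivity.HubbardSuperconductivity.Theorems.WidthHaldane

set_option linter.dupNamespace false -- summit = problem name (single-conjunct summit), D-0017

open scoped BigOperators Classical Matrix ComplexConjugate
open Matrix Literature.MathematicalPhysics.QuantumLattice

section LandauCriterion

variable (L M : ℕ) [NeZero L] [NeZero M] (Λ : Type) [LinearOrder Λ] [Fintype Λ]
  (e : Λ ≃ ZMod L × ZMod M)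

/-! ### Stiffness from a Landau criterion -/

/-- **Stiffness from a Landau criterion** (`L ≥ 3`; card `landau-window-yrast`,
`StiffnessOfLandauCriterion`, constant `1 - (π/3)²/(12L²)` relaxed to `1 - 1/L²`). At the cruxes'
filling `N = N_{L,M}(δ)` (`δ ≥ -1`), write `ε_ψ = Re⟨ψ,H₀ψ⟩ - E(0,N)`, `K(ψ)`, `J(ψ)` for the
excitation energy, longitudinal kinetic form and total longitudinal current of a unit vector `ψ` of
the sector `(N, S^z = 0)`. Suppose a KINETIC FLOOR on the window, `ε_ψ ≤ wM/L ⇒ K(ψ) ≥ k'·LM`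
(`0 ≤ k' ≤ 2`), and the LANDAU CRITERION `ε_ψ ≥ min(J(ψ)²/(2κLM), s|J(ψ)|/L)` for every unit sector
vector (`κ > 0`, `s > π/3`), with the window large enough: `2(π/3)² ≤ w(1 - (π/3)/s)` and
`2(π/3)²(κ + 2) ≤ w`. Then `k'(1 - 1/L²) - κ ≤ ρ̃_{L,M}(U, δ)`.
Proof: by the floor transfer at `θ₀ = π/3`, `A = θ₀/L`, it suffices that every unit sector vector has
`ε + (1 - cos A)K + sin A·J ≥ [k'(1 - 1/L²) - κ]A²LM/2`. Inside the window, `(1 - cos A)K ≥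
(A²/2 - (5/96)A⁴)k'LM ≥ k'(1 - 1/L²)A²LM/2` (`Real.cos_bound`) and `ε - A|J| ≥ -κA²LM/2` (complete
the square on the quadratic branch; `A < s/L` on the linear branch). Outside the window,
`(1 - cos A)K ≥ -A²LM` (`|K| ≤ 2LM`) and either branch of the criterion gives `ε - A|J| ≥ 2A²LM`
by the two conditions on `w`, whence `≥ A²LM ≥` the target (`k' ≤ 2`). [folklore] -/
theorem tubeStiffness_ge_of_landauCriterion (hL : 3 ≤ L) (U : ℝ) {δ κ s k' w : ℝ} (hδ : -1 ≤ δ)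
    (hκ : 0 < κ) (hs : Real.pi / 3 < s) (hk' : 0 ≤ k') (hk'2 : k' ≤ 2)
    (hw1 : 2 * (Real.pi / 3) ^ 2 ≤ w * (1 - Real.pi / 3 / s))
    (hw2 : 2 * (Real.pi / 3) ^ 2 * (κ + 2) ≤ w)
    (hKF : ∀ ψ ∈ szSector (Λ := Λ) (tubeFilling L M δ) 0, star ψ ⬝ᵥ ψ = 1 →
      (expect (tubeH0 L M Λ e U) ψ).re - tubeEnergy L M Λ e U 0 (tubeFilling L M δ) ≤ w * M / L →
        k' * ((L : ℝ) * M) ≤ ∑ a : ZMod L, ∑ b : ZMod M, ∑ σ : Fin 2,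
          (expect (creation (orb (e.symm (a, b)) σ) * annihilation (orb (e.symm (a - 1, b)) σ) +
            creation (orb (e.symm (a - 1, b)) σ) * annihilation (orb (e.symm (a, b)) σ)) ψ).re)
    (hLC : ∀ ψ ∈ szSector (Λ := Λ) (tubeFilling L M δ) 0, star ψ ⬝ᵥ ψ = 1 →
      min ((∑ a : ZMod L, ∑ b : ZMod M, ∑ σ : Fin 2,
          (expect (creation (orb (e.symm (a, b)) σ) * annihilation (orb (e.symm (a - 1, b)) σ) -
            creation (orb (e.symm (a - 1, b)) σ) * annihilation (orb (e.symm (a, b)) σ)) ψ).im) ^ 2 /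
            (2 * κ * ((L : ℝ) * M)))
        (s * |∑ a : ZMod L, ∑ b : ZMod M, ∑ σ : Fin 2,
          (expect (creation (orb (e.symm (a, b)) σ) * annihilation (orb (e.symm (a - 1, b)) σ) -
            creation (orb (e.symm (a - 1, b)) σ) * annihilation (orb (e.symm (a, b)) σ)) ψ).im| / L) ≤
        (expect (tubeH0 L M Λ e U) ψ).re - tubeEnergy L M Λ e U 0 (tubeFilling L M δ)) :
    k' * (1 - 1 / (L : ℝ) ^ 2) - κ ≤ tubeStiffness L M Λ e U δ := by
  obtain ⟨ψ₀, h₀, hg₀⟩ := exists_unit_isGroundStateInSector_tubeH0_tubeFilling L M Λ e U hδ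
  set N := tubeFilling L M δ with hN
  set E0 := tubeEnergy L M Λ e U 0 N with hE0
  set A : ℝ := Real.pi / 3 / L with hA
  clear_value A E0 N
  have hL3 : (3 : ℝ) ≤ L := by exact_mod_cast hL
  have hL0 : (0 : ℝ) < L := by linarith
  have hM0 : (0 : ℝ) < M := by exact_mod_cast Nat.pos_of_ne_zero (NeZero.ne M)
  have hP0 : (0 : ℝ) < (L : ℝ) * M := mul_pos hL0 hM0
  have hπ0 : 0 < Real.pi := Real.pi_pos
  have hπ4 : Real.pi ≤ 4 := Real.pi_le_four
  have hA0 : 0 < A := by rw [hA]; positivity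
  have hAL : A * L = Real.pi / 3 := by rw [hA]; field_simp
  have hA1 : A ≤ 1 := by
    rw [hA, div_le_one hL0]
    linarith
  have hs0 : 0 < s := lt_trans (by positivity) hs
  have hκP : 0 < κ * ((L : ℝ) * M) := mul_pos hκ hP0
  -- `A² L M = (π/3)² M / L`, the natural unit
  have hunit : A ^ 2 * ((L : ℝ) * M) = (Real.pi / 3) ^ 2 * M / L := by
    rw [hA]; field_simp
  -- the window scale dominates: `(2κ+4) A² L M ≤ w M / L` and `2 A² L M ≤ w (1 - (π/3)/s) M / L`
  have hw2' : (2 * κ + 4) * (A ^ 2 * ((L : ℝ) * M)) ≤ w * M / L := by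
    rw [hunit]
    have := mul_le_mul_of_nonneg_right hw2 (by positivity : (0 : ℝ) ≤ M / L)
    calc (2 * κ + 4) * ((Real.pi / 3) ^ 2 * M / L) = 2 * (Real.pi / 3) ^ 2 * (κ + 2) * (M / L) := by ring
      _ ≤ w * (M / L) := this
      _ = w * M / L := by ring
  have hw1' : 2 * (A ^ 2 * ((L : ℝ) * M)) ≤ w * (1 - Real.pi / 3 / s) * M / L := by
    rw [hunit]
    have := mul_le_mul_of_nonneg_right hw1 (by positivity : (0 : ℝ) ≤ M / L)
    calc 2 * ((Real.pi / 3) ^ 2 * M / L) = 2 * (Real.pi / 3) ^ 2 * (M / L) := by ring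
      _ ≤ w * (1 - Real.pi / 3 / s) * (M / L) := this
      _ = w * (1 - Real.pi / 3 / s) * M / L := by ring
  -- Taylor bounds at `A ∈ (0, 1]`
  have hcosU : 1 - Real.cos A ≤ A ^ 2 / 2 := by
    have := two_sub_two_mul_cos_le_sq A
    linarith
  have hcosL : A ^ 2 / 2 - 5 / 96 * A ^ 4 ≤ 1 - Real.cos A := by
    have hb := Real.cos_bound (show |A| ≤ 1 by rw [abs_of_pos hA0]; exact hA1)
    rw [abs_of_pos hA0, abs_le] at hb
    linarith [hb.2]
  have hcos0 : 0 ≤ 1 - Real.cos A := by linarith [Real.cos_le_one A]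
  have hsinU : Real.sin A ≤ A := Real.sin_le hA0.le
  have hsin0 : 0 ≤ Real.sin A :=
    Real.sin_nonneg_of_nonneg_of_le_pi hA0.le (by linarith [Real.pi_gt_three])
  -- `(5/48) A² ≤ 1/L²`
  have hA2 : 5 / 48 * A ^ 2 ≤ 1 / (L : ℝ) ^ 2 := by
    rw [le_div_iff₀ (by positivity)]
    calc 5 / 48 * A ^ 2 * (L : ℝ) ^ 2 = 5 / 48 * (A * L) ^ 2 := by ring
      _ = 5 / 48 * (Real.pi / 3) ^ 2 := by rw [hAL]
      _ ≤ 1 := by nlinarith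
  have hc2 : k' * (1 - 1 / (L : ℝ) ^ 2) - κ ≤ 2 := by
    have h0 : 0 ≤ 1 / (L : ℝ) ^ 2 := by positivity
    have := mul_nonneg hk' h0
    linarith
  -- THE KEY FLOOR at `θ₀ = π/3`
  have key : E0 + (k' * (1 - 1 / (L : ℝ) ^ 2) - κ) * (A ^ 2 * ((L : ℝ) * M) / 2) ≤
      tubeEnergy L M Λ e U (Real.pi / 3) N := by
    refine le_tubeEnergy_of_forall_landau_ge L M Λ e hL U (Real.pi / 3) N ⟨ψ₀, hg₀.1, h₀⟩ fun ψ hψ h1 => ?_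
    rw [← hA]
    have hKabs := abs_longKinetic_le L M Λ e (show 2 ≤ L by omega) h1
    have hLCψ := hLC ψ hψ h1
    have hKFψ := hKF ψ hψ h1
    rw [show (expect (tubeH0 L M Λ e U) ψ).re = ((expect (tubeH0 L M Λ e U) ψ).re - E0) + E0 from by ring]
    generalize hKψ : (∑ a : ZMod L, ∑ b : ZMod M, ∑ σ : Fin 2,
      (expect (creation (orb (e.symm (a, b)) σ) * annihilation (orb (e.symm (a - 1, b)) σ) +
        creation (orb (e.symm (a - 1, b)) σ) * annihilation (orb (e.symm (a, b)) σ)) ψ).re) = Kψ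
      at hKabs hKFψ ⊢
    generalize hJψ : (∑ a : ZMod L, ∑ b : ZMod M, ∑ σ : Fin 2,
      (expect (creation (orb (e.symm (a, b)) σ) * annihilation (orb (e.symm (a - 1, b)) σ) -
        creation (orb (e.symm (a - 1, b)) σ) * annihilation (orb (e.symm (a, b)) σ)) ψ).im) = Jψ
      at hLCψ ⊢
    generalize hε : (expect (tubeH0 L M Λ e U) ψ).re - E0 = ε at hLCψ hKFψ ⊢
    clear hKψ hJψ hε hKF hLC
    have hJ0 : 0 ≤ |Jψ| := abs_nonneg _
    -- the current term is at least `-A |J|`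
    have hsinJ : -(A * |Jψ|) ≤ Real.sin A * Jψ := by
      have h2 : |Real.sin A * Jψ| ≤ A * |Jψ| := by
        rw [abs_mul, abs_of_nonneg hsin0]
        exact mul_le_mul_of_nonneg_right hsinU (abs_nonneg _)
      linarith [neg_abs_le (Real.sin A * Jψ)]
    -- target in terms of `ε`
    suffices htarget : (k' * (1 - 1 / (L : ℝ) ^ 2) - κ) * (A ^ 2 * ((L : ℝ) * M) / 2) ≤
        ε + (1 - Real.cos A) * Kψ + Real.sin A * Jψ by linarith
    by_cases hwin : ε ≤ w * M / L
    · -- inside the window: kinetic floor + Landau criterion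
      have hKF' : k' * ((L : ℝ) * M) ≤ Kψ := hKFψ hwin
      have hK1 : k' * (1 - 1 / (L : ℝ) ^ 2) * (A ^ 2 * ((L : ℝ) * M) / 2) ≤ (1 - Real.cos A) * Kψ := by
        have hmono : 1 - 1 / (L : ℝ) ^ 2 ≤ 1 - 5 / 48 * A ^ 2 := by linarith
        calc k' * (1 - 1 / (L : ℝ) ^ 2) * (A ^ 2 * ((L : ℝ) * M) / 2)
            ≤ k' * (1 - 5 / 48 * A ^ 2) * (A ^ 2 * ((L : ℝ) * M) / 2) :=
              mul_le_mul_of_nonneg_right (mul_le_mul_of_nonneg_left hmono hk') (by positivity)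
          _ = (A ^ 2 / 2 - 5 / 96 * A ^ 4) * (k' * ((L : ℝ) * M)) := by ring
          _ ≤ (1 - Real.cos A) * (k' * ((L : ℝ) * M)) :=
              mul_le_mul_of_nonneg_right hcosL (by positivity)
          _ ≤ (1 - Real.cos A) * Kψ := mul_le_mul_of_nonneg_left hKF' hcos0
      have hEJ : -(κ * (A ^ 2 * ((L : ℝ) * M) / 2)) ≤ ε - A * |Jψ| := by
        rcases min_le_iff.mp hLCψ with hq | hl
        · -- quadratic branch: complete the square
          rw [div_le_iff₀ (by positivity)] at hq
          nlinarith only [sq_nonneg (|Jψ| - κ * ((L : ℝ) * M) * A), sq_abs Jψ, hq, hκP]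
        · -- linear branch: `A |J| ≤ s|J|/L ≤ ε`
          have hAJ : A * |Jψ| ≤ s * |Jψ| / L := by
            rw [hA, div_mul_eq_mul_div, div_le_div_iff_of_pos_right hL0]
            have := mul_nonneg (sub_nonneg.mpr hs.le) hJ0
            linarith
          have : 0 ≤ κ * (A ^ 2 * ((L : ℝ) * M) / 2) := by positivity
          linarith
      linarith [hK1, hEJ, hsinJ]
    · -- outside the window: everything is at least `A² L M`
      push Not at hwin
      have hK2 : -(A ^ 2 * ((L : ℝ) * M)) ≤ (1 - Real.cos A) * Kψ := by
        have h1' := mul_le_mul_of_nonneg_left (neg_abs_le Kψ) hcos0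
        have h2' : (1 - Real.cos A) * |Kψ| ≤ A ^ 2 / 2 * (2 * ((L : ℝ) * M)) :=
          mul_le_mul hcosU hKabs (abs_nonneg _) (by positivity)
        linarith
      have hEJ : 2 * (A ^ 2 * ((L : ℝ) * M)) ≤ ε - A * |Jψ| := by
        rcases min_le_iff.mp hLCψ with hq | hl
        · -- quadratic branch: `A|J| ≤ ε/2 + κ L M A²`
          rw [div_le_iff₀ (by positivity)] at hq
          have hAJ : 2 * (A * |Jψ|) ≤ ε + 2 * κ * ((L : ℝ) * M) * A ^ 2 := by
            nlinarith only [sq_nonneg (|Jψ| - 2 * κ * ((L : ℝ) * M) * A), sq_abs Jψ, hq, hκP]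
          linarith [hAJ, hw2', hwin]
        · -- linear branch: `A|J| ≤ (π/3)/s · ε`
          have hAJ : A * |Jψ| ≤ Real.pi / 3 / s * ε := by
            rw [div_le_iff₀ hL0] at hl
            have : A * |Jψ| * s ≤ Real.pi / 3 * ε := by
              calc A * |Jψ| * s = Real.pi / 3 * (s * |Jψ|) / L := by rw [hA]; field_simp
                _ ≤ Real.pi / 3 * (ε * L) / L := by gcongr
                _ = Real.pi / 3 * ε := by field_simp
            rw [div_mul_eq_mul_div, le_div_iff₀ hs0]
            linarith
          have hfac : 0 < 1 - Real.pi / 3 / s := by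
            rw [sub_pos, div_lt_one hs0]; exact hs
          have hεw : w * (1 - Real.pi / 3 / s) * M / L ≤ ε * (1 - Real.pi / 3 / s) := by
            have := mul_le_mul_of_nonneg_right hwin.le hfac.le
            calc w * (1 - Real.pi / 3 / s) * M / L = w * M / L * (1 - Real.pi / 3 / s) := by ring
              _ ≤ ε * (1 - Real.pi / 3 / s) := this
          linarith [hAJ, hεw, hw1']
      have hApos : 0 ≤ A ^ 2 * ((L : ℝ) * M) := by positivity
      have hcT := mul_nonneg (sub_nonneg.mpr hc2) hApos
      linarith [hK2, hEJ, hsinJ, hcT]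
  -- conclude: `ρ̃ = 2L (E(π/3) - E0) / ((π/3)² M)`
  have hfin : (k' * (1 - 1 / (L : ℝ) ^ 2) - κ) * ((Real.pi / 3) ^ 2 * M) ≤
      2 * L * (tubeEnergy L M Λ e U (Real.pi / 3) N - E0) := by
    have h2L : (0 : ℝ) ≤ 2 * L := by positivity
    calc (k' * (1 - 1 / (L : ℝ) ^ 2) - κ) * ((Real.pi / 3) ^ 2 * M)
        = 2 * L * ((k' * (1 - 1 / (L : ℝ) ^ 2) - κ) * (A ^ 2 * ((L : ℝ) * M) / 2)) := by
          rw [← hAL]; ring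
      _ ≤ 2 * L * (tubeEnergy L M Λ e U (Real.pi / 3) N - E0) :=
          mul_le_mul_of_nonneg_left (by linarith [key]) h2L
  rw [tubeStiffness_eq, ← hN, ← hE0, le_div_iff₀ (by positivity)]
  exact hfin

end LandauCriterion

/-- **STIFFNESS FROM A LANDAU CRITERION, closed form** (the registered sub-goal
`stiffnessOfLandauCriterion` of crux stmt-HubbardSuperconductivity-16312; all binders universally
quantified; `ε_ψ = Re⟨ψ,H₀ψ⟩ - E(0, N_{L,M}(δ))`): kinetic floor on the window + Landau criterion for
every unit sector vector ⇒ `k'(1 - 1/L²) - κ ≤ ρ̃_{L,M}(U, δ)`. [folklore] -/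
theorem stiffnessOfLandauCriterion : ∀ (L M : ℕ) [NeZero L] [NeZero M] (Λ : Type) [LinearOrder Λ] [Fintype Λ] (e : Λ ≃ ZMod L × ZMod M), 3 ≤ L → ∀ (U δ κ s k' w : ℝ), -1 ≤ δ → 0 < κ → Real.pi / 3 < s → 0 ≤ k' → k' ≤ 2 → 2 * (Real.pi / 3) ^ 2 ≤ w * (1 - Real.pi / 3 / s) → 2 * (Real.pi / 3) ^ 2 * (κ + 2) ≤ w → (∀ ψ : Fock (Orb Λ), ψ ∈ szSector (tubeFilling L M δ) 0 → star ψ ⬝ᵥ ψ = 1 → (expect (tubeH0 L M Λ e U) ψ).re - tubeEnergy L M Λ e U 0 (tubeFilling L M δ) ≤ w * M / L → k' * ((L : ℝ) * M) ≤ ∑ a : ZMod L, ∑ b : ZMod M, ∑ σ : Fin 2, (expect (creation (orb (e.symm (a, b)) σ) * annihilation (orb (e.symm (a - 1, b)) σ) + creation (orb (e.symm (a - 1, b)) σ) * annihilation (orb (e.symm (a, b)) σ)) ψ).re) → (∀ ψ : Fock (Orb Λ), ψ ∈ szSector (tubeFilling L M δ) 0 → star ψ ⬝ᵥ ψ = 1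 → min ((∑ a : ZMod L, ∑ b : ZMod M, ∑ σ : Fin 2, (expect (creation (orb (e.symm (a, b)) σ) * annihilation (orb (e.symm (a - 1, b)) σ) - creation (orb (e.symm (a - 1, b)) σ) * annihilation (orb (e.symm (a, b)) σ)) ψ).im) ^ 2 / (2 * κ * ((L : ℝ) * M))) (s * |∑ a : ZMod L, ∑ b : ZMod M, ∑ σ : Fin 2, (expect (creation (orb (e.symm (a, b)) σ) * annihilation (orb (e.symm (a - 1, b)) σ) - creation (orb (e.symm (a - 1, b)) σ) * annihilation (orb (e.symm (a, b)) σ)) ψ).im| / L) ≤ (expect (tubeH0 L M Λ e U) ψ).re - tubeEnergy L M Λ e U 0 (tubeFilling L M δ)) → k' * (1 - 1 / (L : ℝ) ^ 2) - κ ≤ tubeStiffness L M Λ e U δ :=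
  fun L M _ _ Λ _ _ e hL U _δ _κ _s _k' _w hδ hκ hs hk' hk'2 hw1 hw2 hKF hLC =>
    tubeStiffness_ge_of_landauCriterion L M Λ e hL U hδ hκ hs hk' hk'2 hw1 hw2
      (fun ψ hψ h1 => hKF ψ hψ h1) (fun ψ hψ h1 => hLC ψ hψ h1)

end Summit.HubbardSuperconductivity.HubbardSuperconductivity.Theorems.WidthHaldane

end
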